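import Summits.Ventures.PackingBounds.Energy.FivePointThomson
import Summits.Ventures.PackingBounds.Configurations.FivePointConfigs
import HarnessLib

/-!
# Thomson's problem for five electrons: the two-sided statement

Framing: lottery ticket; floor = certified bounds/negative ranges. Venture `PackingBounds`, cell
`pub-packcert`, energy family E3PT (pub-packcert-energy gen 11).

Combines the kernel-checked sharp three-point bound `FivePointThomson.thomson_five_points`
(`Σ_{x ≠ y} 1/‖x-y‖ ≥ 1 + 6√2 + 2√3` for every five unit vectors of `ℝ³`) with the explicit triangular
bipyramid `Config.Bipyramid.pts` (inner products `-1, -1/2, 0`; `Config.Bipyramid.energy_pts`): the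
minimum of the Coulomb energy of five unit point charges on `S²` is exactly `1 + 6√2 + 2√3` over ordered
pairs, i.e. `E_Coulomb = 1/2 + 3√2 + √3 ≈ 6.4747`, attained by the triangular bipyramid
(R. E. Schwartz, Exp. Math. 22 (2013); here by an exact SDP certificate over `ℚ(√2,√3)`).
-/

noncomputable section

open Finset
open scoped RealInnerProductSpace

namespace Summit.Ventures.PackingBounds.Energy.FivePointThomson

open Summit.Ventures.PackingBounds.Config

/-- `1/√2 = √2/2`. -/
private theorem one_div_sqrt_two : 1 / Real.sqrt 2 = Real.sqrt 2 / 2 := by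
  have p2 : 0 < Real.sqrt 2 := Real.sqrt_pos.2 (by norm_num)
  rw [div_eq_div_iff p2.ne' two_ne_zero, one_mul, Real.mul_self_sqrt (by norm_num)]

/-- `1/√3 = √3/3`. -/
private theorem one_div_sqrt_three : 1 / Real.sqrt 3 = Real.sqrt 3 / 3 := by
  have p3 : 0 < Real.sqrt 3 := Real.sqrt_pos.2 (by norm_num)
  rw [div_eq_div_iff p3.ne' (by norm_num : (3 : ℝ) ≠ 0), one_mul, Real.mul_self_sqrt (by norm_num)]

/-- The triangular bipyramid has Coulomb energy `1 + 6√2 + 2√3` over ordered pairs (distances `2` once,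
`√2` six times, `√3` three times among unordered pairs). -/
theorem bipyramid_coulomb_energy :
    ∑ x ∈ Bipyramid.pts, ∑ y ∈ Bipyramid.pts.erase x, 1 / ‖x - y‖ =
      1 + 6 * Real.sqrt 2 + 2 * Real.sqrt 3 := by
  have h : ∀ x ∈ Bipyramid.pts, ∀ y ∈ Bipyramid.pts.erase x,
      1 / ‖x - y‖ = (fun t : ℝ => 1 / Real.sqrt (2 - 2 * t)) (inner ℝ x y) := by
    intro x hx y hy
    have hyC : y ∈ Bipyramid.pts := Finset.mem_of_mem_erase hy
    have hn : ‖x - y‖ ^ 2 = 2 - 2 * inner ℝ x y := by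
      rw [@norm_sub_sq_real, Bipyramid.norm_pts x hx, Bipyramid.norm_pts y hyC]; ring
    have hxy : ‖x - y‖ = Real.sqrt (2 - 2 * inner ℝ x y) := by
      rw [← hn, Real.sqrt_sq (norm_nonneg _)]
    simp only [hxy]
  have e := Bipyramid.energy_pts (fun t : ℝ => 1 / Real.sqrt (2 - 2 * t))
  rw [Finset.sum_congr rfl fun x hx => Finset.sum_congr rfl fun y hy => h x hx y hy, e]
  show 2 * (1 / Real.sqrt (2 - 2 * (-1 : ℝ)) + 3 * (1 / Real.sqrt (2 - 2 * 0)))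
      + 3 * (2 * (1 / Real.sqrt (2 - 2 * 0)) + 2 * (1 / Real.sqrt (2 - 2 * (-1 / 2 : ℝ)))) = _
  have h4 : Real.sqrt (2 - 2 * (-1 : ℝ)) = 2 := by
    rw [show (2 : ℝ) - 2 * (-1 : ℝ) = 2 ^ 2 by norm_num, Real.sqrt_sq (by norm_num : (0 : ℝ) ≤ 2)]
  have h0 : Real.sqrt (2 - 2 * (0 : ℝ)) = Real.sqrt 2 := by norm_num
  have hh : Real.sqrt (2 - 2 * (-1 / 2 : ℝ)) = Real.sqrt 3 := by norm_num
  rw [h4, h0, hh, one_div_sqrt_two, one_div_sqrt_three]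
  ring

/-- **Thomson's problem for five electrons, two-sided:** the least value of `Σ_{x ≠ y} 1/‖x-y‖` over
five unit vectors of `ℝ³` is `1 + 6√2 + 2√3`, attained by the triangular bipyramid. -/
theorem thomson_five_points_isLeast :
    IsLeast {E : ℝ | ∃ C : Finset (EuclideanSpace ℝ (Fin 3)), C.card = 5 ∧ (∀ x ∈ C, ‖x‖ = 1) ∧
      E = ∑ x ∈ C, ∑ y ∈ C.erase x, 1 / ‖x - y‖} (1 + 6 * Real.sqrt 2 + 2 * Real.sqrt 3) := by
  refine ⟨⟨Bipyramid.pts, Bipyramid.card_pts, Bipyramid.norm_pts, bipyramid_coulomb_energy.symm⟩, ?_⟩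
  rintro E ⟨C, h5, hC, rfl⟩
  exact thomson_five_points C hC h5

/-- The same in the physicists' normalisation (unordered pairs): the minimal Coulomb energy of five unit
charges on the unit sphere is `1/2 + 3√2 + √3`. -/
theorem thomson_five_points_isLeast_half :
    IsLeast {E : ℝ | ∃ C : Finset (EuclideanSpace ℝ (Fin 3)), C.card = 5 ∧ (∀ x ∈ C, ‖x‖ = 1) ∧
      E = (∑ x ∈ C, ∑ y ∈ C.erase x, 1 / ‖x - y‖) / 2} (1 / 2 + 3 * Real.sqrt 2 + Real.sqrt 3) := by
  refine ⟨⟨Bipyramid.pts, Bipyramid.card_pts, Bipyramid.norm_pts, ?_⟩, ?_⟩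
  · rw [bipyramid_coulomb_energy]; ring
  · rintro E ⟨C, h5, hC, rfl⟩
    have h := thomson_five_points C hC h5
    linarith

end Summit.Ventures.PackingBounds.Energy.FivePointThomson
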